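import Mathlib
import HarnessLib
import Summits.HubbardSuperconductivity.HubbardSuperconductivity.Theses.KLProgramme

/-!
# Route `KLProgramme`, crux K3 `KLRegimeTwoPointLimit` (stmt-HubbardSuperconductivity-19937): the registered stub
# `stub_MuOfDopingWindow` of the birth skeleton (ba62972cfd2b), SERVED by name

The K3 birth skeleton (`KLRegimeTwoPointLimit_of`, skeleton ba62972cfd2b, planner g6) has three registered stubs:
`stub_KLRegime_mu : KLRegimeAnalysisWindow` (the analysis on the window `μ ∈ [-1, -0.15]`),
`stub_MuOfDopingWindow : …Theses.KLProgramme.MuOfDopingWindow` (the route's support statement S0) and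
`stub_KLRegime_cell : KLRegimeCertifiedCell` (the same analysis on the certified cell `[-0.4292, -0.4242]`).
S0 (item stmt-…-19939) is CLOSED `proved` by
`Summit.HubbardSuperconductivity.HubbardSuperconductivity.Theorems.muOfDopingWindow_proof` (the route file records it as
`MuOfDopingWindow_holds`).  This file only restates that closed fact under the stub's registered name and signature, so that the
K3 skeleton's ledger shows the S0 input as served (the proof is cited by name; nothing is re-derived), exactly as the sibling
crux K1 does in `…Theorems.H10TwoPointLimitStubs.stub_MuOfDopingWindow`. [folklore]
-/

namespace Summit.HubbardSuperconductivity.HubbardSuperconductivity.Theorems.KLRegimeTwoPointLimitStubs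

set_option linter.dupNamespace false -- summit = problem name (single-conjunct summit), D-0017

/-- **Stub `stub_MuOfDopingWindow` of the K3 skeleton**: `∀ δ ∈ [0.10, 0.35], μ(δ) ∈ [-1, -0.15]` — the route decl
`MuOfDopingWindow`, by `muOfDopingWindow_proof` (item stmt-…-19939, via the route file's `MuOfDopingWindow_holds`). [folklore] -/
theorem stub_MuOfDopingWindow : Summit.HubbardSuperconductivity.HubbardSuperconductivity.Theses.KLProgramme.MuOfDopingWindow :=
  Summit.HubbardSuperconductivity.HubbardSuperconductivity.Theses.KLProgramme.MuOfDopingWindow_holds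

end Summit.HubbardSuperconductivity.HubbardSuperconductivity.Theorems.KLRegimeTwoPointLimitStubs
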